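import Summits.KontsevichZagierPeriods.KontsevichZagierPeriods.Theses.AbelContraction
import Summits.KontsevichZagierPeriods.KontsevichZagierPeriods.Theorems.AbelContractionRealArcKernelSplit
import Summits.KontsevichZagierPeriods.KontsevichZagierPeriods.Theorems.AbelContractionRealArcKernelStubCurrency

/-!
# Crux `RealArcKernel` (stmt-KontsevichZagierPeriods-12472, route AbelContraction, rank 0) — line
# `dimtwo_redirect`, lead skeleton v3 (lead c5, 2026-08-17: stubs = the two split children VERBATIM)

  `RealArcKernel` : every subgroup `R ≥ KZ.relations` of `KZ.FormalRep` that contains every value-`0`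
  element of the one-curve real hyperelliptic sector contains `ker KZ.eval`.

The line (crux-strategist cstrat-12472) peels one OPEN layer along the input-dimension filtration:
`RealArcKernel ⟸ KZDimTwo ∧ ReductionToDimensionTwo`, the split glue being LANDED
(`RealArcKernelSplit.realArcKernel_of_subs`, p148174) together with
`RealArcKernelSplit.reductionToDimensionTwo_of_realArcKernel` (the reduction is NECESSARY for the crux).

RESHAPE v3 (lead c5). Skeleton v2 (lead c3) carried, in place of `stub_kzDimTwo`, the residual stub
`stub_solidVolumes` of item stmt-4280's own line `bounded_solids` (Hilbert's third problem for bounded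
`ℚ`-semialgebraic solids of `ℝ³` inside the calculus), after its two provable sub-stubs had landed here
(`stub_solids` p148539, `stub_mergeSolids` p148371). Lead c5 proved what that stub IS
(`RealArcKernelStubCurrency`, p156740): `stub_solidVolumes ⟺` Conjecture 1 for pairs of PLANAR integrals with
arbitrary real-algebraic integrands (`solidVolumes_iff_planarPairs`; all rungs: `VolSolid (d+1) ⟺` pairs of
dimension `d ⟺` pairs of dimensions `≤ d`, `RedSolid (d+1) ⟺ RedPairs d`), i.e. item stmt-4280 with the
hypothesis `IsRational` DELETED. That statement implies stmt-4280 and has strictly larger CONTENT (the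
coincidences a completeness proof must derive by moves; as bare statements both follow from the summit):
periods of rational `2`-forms over `ℚ`-semialgebraic planar domains are periods of complements of curves in
rational surfaces relative to curves — mixed, built from `H¹` of curves and Tate classes, all Hodge types
`(p,q)` with `|p − q| ≤ 1` — whereas planar integrals of algebraic integrands (= volumes of bounded solids of
`ℝ³`) realise the `(2,0)`-periods of double planes (products `ω₁ω₂` of elliptic periods, Legendre's relation
`ω₁η₂ − ω₂η₁ = 2πi` as `∫∫ f(x)g(y)`, K3 periods), whose relations come from cup product / the Weil pairing.
The crux needs only stmt-4280 (landed glue), so v3 books EXACTLY the two split children, each an existing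
item stated verbatim:

* `stub_kzDimTwo` — Conjecture 1 on the dimension-two stratum (= item stmt-KontsevichZagierPeriods-4280
  `KZDimTwo` verbatim; rank-0 target of route BianchiHumbert, wanted by five routes; open problem: `ζ(2) ∈ ℚπ²`
  as a move chain, Clausen / dilogarithm values at algebraic points, `L(2,χ)`; its registered line
  `bounded_solids` has the one open stub `stub_solidVolumes` = `VolSolid 3`, SUFFICIENT by
  `stub_kzDimTwo_of_planarPairs` below);
* `stub_reductionToDimensionTwo` — the kernel conjecture MODULO the dimension-two stratum (= item
  stmt-KontsevichZagierPeriods-18030 `ReductionToDimensionTwo` verbatim; GPC-strength modulo the OPEN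
  stratum; NECESSARY for the crux — `stub_reductionToDimensionTwo_necessary` below; its own line is
  `Cruxes/RealArcKernel/Lines/reddim2_ladder.lean`).

Composition (sorry-free over the stubs): `realArcKernel_of_stubs : RealArcKernel`; parametric form
`RealArcKernel_of : KZDimTwo → ReductionToDimensionTwo → RealArcKernel` over the route decls by name.
Position of the children on the volume ladder (all landed, `RealArcKernelStubCurrency`,
`RealArcKernelVolumeFiltration`, `RealArcKernelSplit`): `PlanarAreas` (4990) `= VolSolid 2`,
`VolSolid 3 → KZDimTwo → VolSolid 2`; `ReductionToDimensionOne` (14403) `= RedSolid 2`,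
`RedSolid 2 → ReductionToDimensionTwo → RedSolid 3`; summit `= VolSolid (d+1) ∧ RedSolid (d+1)` for every
`d`. No `Disproof.lean` exists for this crux; negatives index: KinematicPlaneConvex only (no convexity here).

References: M. Kontsevich, D. Zagier, *Periods* (2001), §1.2 Conjecture 1; J. Cresson, J. Viu-Sos (2022)
§1; J. Viu-Sos (2021) Thm 1.1; A. Huber, S. Müller-Stach (2017), Ch. 13; P. Deligne, *Théorie de Hodge II*
(1971), §3.2 (weights of complements).
-/

noncomputable section

open Literature.NumberTheory.Transcendental

namespace Summit.KontsevichZagierPeriods.KontsevichZagierPeriods.Cruxes.RealArcKernel.DimtwoRedirect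

/-! ## Registered stubs (the two split children, verbatim) -/

/-- **Conjecture 1 on the dimension-two stratum** (= item stmt-KontsevichZagierPeriods-4280 `KZDimTwo`
verbatim): two KZ-rational representations of dimensions `≤ 2` with equal value are KZ-equivalent.
[size open-problem, XL] [cite: KontsevichZagier2001, §1.2 Conjecture 1] -/
theorem stub_kzDimTwo :
    ∀ ⦃n m : ℕ⦄, n ≤ 2 → m ≤ 2 → ∀ (r : KZ.IntegralRep n) (r' : KZ.IntegralRep m),
      r.IsRational → r'.IsRational → r.value = r'.value → KZ.Equivalent r r' := by
  sorry

/-- **The kernel conjecture modulo the dimension-two stratum** (= item stmt-KontsevichZagierPeriods-18030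
`ReductionToDimensionTwo` verbatim; GPC-strength modulo the OPEN stratum, stated openly; NECESSARY for
the crux). [size open-problem] [cite: KontsevichZagier2001, §1.2 Conjecture 1] -/
theorem stub_reductionToDimensionTwo :
    ∀ R : AddSubgroup KZ.FormalRep, KZ.relations ≤ R →
      (∀ ⦃n m : ℕ⦄, n ≤ 2 → m ≤ 2 → ∀ (r : KZ.IntegralRep n) (r' : KZ.IntegralRep m),
        r.IsRational → r'.IsRational → r.value = r'.value → KZ.of r - KZ.of r' ∈ R) →
      ∀ x : KZ.FormalRep, KZ.eval x = 0 → x ∈ R := by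
  sorry

/-! ## The stubs are the route's items verbatim (kernel-checked identifications) -/

example : (∀ ⦃n m : ℕ⦄, n ≤ 2 → m ≤ 2 → ∀ (r : KZ.IntegralRep n) (r' : KZ.IntegralRep m),
      r.IsRational → r'.IsRational → r.value = r'.value → KZ.Equivalent r r') ↔
    Summit.KontsevichZagierPeriods.KontsevichZagierPeriods.Theses.AbelContraction.KZDimTwo :=
  Iff.rfl

example : (∀ R : AddSubgroup KZ.FormalRep, KZ.relations ≤ R →
      (∀ ⦃n m : ℕ⦄, n ≤ 2 → m ≤ 2 → ∀ (r : KZ.IntegralRep n) (r' : KZ.IntegralRep m),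
        r.IsRational → r'.IsRational → r.value = r'.value → KZ.of r - KZ.of r' ∈ R) →
      ∀ x : KZ.FormalRep, KZ.eval x = 0 → x ∈ R) ↔
    Summit.KontsevichZagierPeriods.KontsevichZagierPeriods.Theses.AbelContraction.ReductionToDimensionTwo :=
  Iff.rfl

/-! ## What is known about each stub (landed, sorry-free) -/

/-- **A sufficient special currency for `stub_kzDimTwo`** (the residual stub of v2 / of stmt-4280's line
`bounded_solids`, one rung up): Conjecture 1 for pairs of planar integrals with arbitrary real-algebraic
integrands — equivalently `VolSolid 3`, Hilbert III for bounded `ℚ`-semialgebraic solids inside the calculus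
(`RealArcKernelStubCurrency.solidVolumes_iff_planarPairs`) — implies the stub
(`RealArcKernelStubCurrency.kzDimTwo_of_planarPairs`). [cite: KontsevichZagier2001, §1.2 Conjecture 1] -/
theorem stub_kzDimTwo_of_planarPairs
    (hP : ∀ (a b : KZ.IntegralRep 2), a.value = b.value → KZ.Equivalent a b) :
    Summit.KontsevichZagierPeriods.KontsevichZagierPeriods.Theses.AbelContraction.KZDimTwo :=
  Summit.KontsevichZagierPeriods.AbelContraction.RealArcKernelStubCurrency.kzDimTwo_of_planarPairs hP

/-- **`stub_reductionToDimensionTwo` is NECESSARY**: the crux implies it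
(`RealArcKernelSplit.reductionToDimensionTwo_of_realArcKernel`: a value-`0` element of the sector is
`≡ [r] − [r′]` inside dimension one, and one-dimensional pairs are one Newton–Leibniz move from KZ-rational
two-dimensional pairs). So no proof of the crux avoids item stmt-18030. [cite: KontsevichZagier2001, §1.2] -/
theorem stub_reductionToDimensionTwo_necessary
    (h : Summit.KontsevichZagierPeriods.KontsevichZagierPeriods.Theses.AbelContraction.RealArcKernel) :
    Summit.KontsevichZagierPeriods.KontsevichZagierPeriods.Theses.AbelContraction.ReductionToDimensionTwo :=
  Summit.KontsevichZagierPeriods.AbelContraction.RealArcKernelSplit.reductionToDimensionTwo_of_realArcKernel h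

/-- **Both stubs follow from the summit** (so the line cannot die at a false stub unless the summit is
false): `KontsevichZagierPeriods → KZDimTwo ∧ ReductionToDimensionTwo`
(`RealArcKernelSplit.kzDimTwo_of_kontsevichZagierPeriods`, `…reductionToDimensionTwo_of_kontsevichZagierPeriods`).
[cite: KontsevichZagier2001, §1.2 Conjecture 1] -/
theorem stubs_of_kontsevichZagierPeriods (h : KontsevichZagierPeriods) :
    Summit.KontsevichZagierPeriods.KontsevichZagierPeriods.Theses.AbelContraction.KZDimTwo ∧
      Summit.KontsevichZagierPeriods.KontsevichZagierPeriods.Theses.AbelContraction.ReductionToDimensionTwo :=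
  ⟨Summit.KontsevichZagierPeriods.AbelContraction.RealArcKernelSplit.kzDimTwo_of_kontsevichZagierPeriods h,
    Summit.KontsevichZagierPeriods.AbelContraction.RealArcKernelSplit.reductionToDimensionTwo_of_kontsevichZagierPeriods h⟩

/-! ## Composition (sorry-free): the two stubs imply the crux BY NAME -/

/-- **The skeleton** (hypothesis-free; the registered stubs enter BY NAME): the landed split glue
`realArcKernel_of_subs` fed with the two stubs. [cite: KontsevichZagier2001, §1.2] -/
theorem realArcKernel_of_stubs :
    Summit.KontsevichZagierPeriods.KontsevichZagierPeriods.Theses.AbelContraction.RealArcKernel :=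
  Summit.KontsevichZagierPeriods.AbelContraction.RealArcKernelSplit.realArcKernel_of_subs
    stub_kzDimTwo stub_reductionToDimensionTwo

/-- **`RealArcKernel_of`**, parametric form over the route decls BY NAME:
`KZDimTwo → ReductionToDimensionTwo → RealArcKernel` (= the landed split glue
`RealArcKernelSplit.realArcKernel_of_subs`, p148174). [cite: KontsevichZagier2001, §1.2] -/
theorem RealArcKernel_of :
    Summit.KontsevichZagierPeriods.KontsevichZagierPeriods.Theses.AbelContraction.KZDimTwo →
    Summit.KontsevichZagierPeriods.KontsevichZagierPeriods.Theses.AbelContraction.ReductionToDimensionTwo →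
    Summit.KontsevichZagierPeriods.KontsevichZagierPeriods.Theses.AbelContraction.RealArcKernel :=
  Summit.KontsevichZagierPeriods.AbelContraction.RealArcKernelSplit.realArcKernel_of_subs

end Summit.KontsevichZagierPeriods.KontsevichZagierPeriods.Cruxes.RealArcKernel.DimtwoRedirect

end
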